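import Mathlib
import HarnessLib
import Literature.NumberTheory.Irrationality.Zudilin2014.SecondTalePadic
import Summits.KontsevichZagierPeriods.Zeta5Search.TwoTaleP15SliceLemmas
import Summits.KontsevichZagierPeriods.Zeta5Search.FourthOrderFrameNorms

/-!
# Zudilin's second tale: `A_k, B_k ∈ ℤ_p` for every prime LARGER THAN THE PARAMETER SPANS (generic large-prime integrality)

HONEST FRAMING: systematic search; no irrationality claim unless certified.  Cell pub-zeta5 (P1 g12); p-adic
bookkeeping only, for GENERAL admissible second-tale data `(â, b̂)` of [Zudilin2014ZetaTwo, §6]; nothing about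
irrationality and no number of the cell moves.  This is the generic form of the 'large-prime' half of the P15 slice
files (`TwoTaleP15SliceLemmas.padicNorm_coefAT_le_one/padicNorm_coefBT_le_one`, there proved through the
P15-specific δ-refined digit stack `TwoTaleP15SecondTaleB*`): for a prime `p` exceeding every parameter span —
the numerator block lengths `â₀ − b̂₀`, `â₁ − b̂₁`, the pole block lengths `b̂₂ − â₂`, `b̂₃ − â₃` and the pole span
`b̂₃* − â₂* = bMax − min(â₂, â₃)` — NO digit counting is needed at all:
* the numerator factorials `(â₀−b̂₀)!`, `(â₁−b̂₁)!` are `p`-units (`padicNorm_facZ_eq_one_of_lt`; the pole factorials are integers);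
* every cover-up product `∏_{i ≠ k}(i − k)` over a pole block is a `p`-unit, on or off the block, because
  `0 < |i − k| < p` (`padicNorm_coverProd_eq_one`), and the logarithmic-derivative sums `Σ_{i≠k} 1/(i−k)` are
  `p`-integral (`padicNorm_sum_inv_le_one`);
* the numerator blocks and their DERIVATIVES take INTEGER values at `−k` (`block`/`block2` are images of integer
  polynomials: `padicNorm_eval_block_le_one`, `padicNorm_eval_derivative_block_le_one`, and the doubled versions);
whence, by the tree's factorisations `numT_div_dhatT_eq`, `coefBT_double_eq`, `coefBT_of_simple`
(`Literature/…/Zudilin2014/SecondTalePadic`):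
* **`padicNorm_coefAT_le_one_of_large`** — `‖A_k‖_p ≤ 1` on the double-pole range;
* **`padicNorm_coefBT_le_one_of_large`** — `‖B_k‖_p ≤ 1` on the whole `B`-range `[â₂,b̂₂) ∪ [â₃,b̂₃)`.
At P15 the hypotheses read `p > 17n` (spans 17n, 5n, 11n+1, 11n+1, 13n+1), at RUNG D1 = L(1/3) `p > 25n` (spans
25n, 7n, 16n+1, 16n+1, 19n+1) — exactly the slice thresholds `T₁` of fam-denom's RUNGD.md §2 — so the D1 slice file
F7 of `D1-DESIGN-NOTE.md` needs no port of the P15 digit stack (P1 g12 finding 17:36Z, resolved here).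
References: W. Zudilin, arXiv:1310.1526 [Zudilin2014ZetaTwo] §6, eq. (T2)–(T3); W. Zudilin, J. Théor. Nombres
Bordeaux 16 (2004) [Zudilin2004OddZeta] Lemmas 1–4 (the cover-up bookkeeping).
-/

noncomputable section

open Finset Polynomial
open Literature.NumberTheory.Irrationality.Zudilin2014

namespace Summit.KontsevichZagierPeriods.Zeta5Search.SecondTaleLargePrime

open Summit.KontsevichZagierPeriods.Zeta5Search.SecondOrder (padicNorm_int_eq_one_of_abs_lt)

variable {p : ℕ} [hp : Fact p.Prime]

/-! ### Units: small factorials and cover-up products of short blocks -/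

/-- `m! ` is a `p`-unit for `0 ≤ m < p`. -/
theorem padicNorm_facZ_eq_one_of_lt {m : ℤ} (h0 : 0 ≤ m) (hm : m < p) : padicNorm p (facZ m) = 1 := by
  have hp1 : (1 : ℤ) < p := by exact_mod_cast hp.out.one_lt
  have hm2 : m < (p : ℤ) ^ 2 := by nlinarith
  rw [padicNorm_facZ h0 hm2, Int.ediv_eq_zero_of_lt h0 hm, neg_zero, zpow_zero]

/-- **Cover-up products of short blocks are units**: if every `i ≠ k` of the block satisfies `|i − k| < p`, then
`‖∏_{i ∈ [lo,hi), i ≠ k} (i − k)‖_p = 1` (whether or not `k` lies in the block). -/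
theorem padicNorm_coverProd_eq_one {lo hi k : ℤ} (h : ∀ i ∈ Ico lo hi, i ≠ k → |i - k| < p) :
    padicNorm p (coverProd lo hi k) = 1 := by
  unfold coverProd
  refine TwoTaleP15.padicNorm_prod_eq_one fun i hi => ?_
  have hik := (mem_erase.1 hi)
  have e : ((i : ℚ) - k) = (((i - k : ℤ)) : ℚ) := by push_cast; ring
  rw [e]
  exact padicNorm_int_eq_one_of_abs_lt (sub_ne_zero.2 hik.1) (h i hik.2 hik.1)

/-- The logarithmic-derivative sum over a short pole block is `p`-integral:
`‖Σ_{i ∈ [lo,hi), i ≠ k} 1/(i − k)‖_p ≤ 1` when `|i − k| < p` for those `i`. -/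
theorem padicNorm_sum_inv_le_one {lo hi k : ℤ} (h : ∀ i ∈ Ico lo hi, i ≠ k → |i - k| < p) :
    padicNorm p (∑ i ∈ (Ico lo hi).erase k, 1 / ((i : ℚ) - k)) ≤ 1 := by
  refine padicNorm.sum_le' (fun i hi => ?_) zero_le_one
  have hik := mem_erase.1 hi
  have e : ((i : ℚ) - k) = (((i - k : ℤ)) : ℚ) := by push_cast; ring
  rw [e, padicNorm.div, padicNorm_int_eq_one_of_abs_lt (sub_ne_zero.2 hik.1) (h i hik.2 hik.1), div_one]
  simp

/-! ### Integer values of the numerator blocks and of their derivatives -/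

omit hp in
/-- `block lo hi` is the image of an integer polynomial. -/
theorem block_eq_map (lo hi : ℤ) :
    block lo hi = (∏ i ∈ Ico lo hi, (X + C i : ℤ[X])).map (Int.castRingHom ℚ) := by
  unfold block
  rw [Polynomial.map_prod]
  refine prod_congr rfl fun i _ => ?_
  simp

omit hp in
/-- `block2 lo hi` is the image of an integer polynomial. -/
theorem block2_eq_map (lo hi : ℤ) :
    block2 lo hi = (∏ l ∈ Ico lo hi, (C (2 : ℤ) * X + C l : ℤ[X])).map (Int.castRingHom ℚ) := by
  unfold block2
  rw [Polynomial.map_prod]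
  refine prod_congr rfl fun i _ => ?_
  simp [map_ofNat C 2]

/-- The image of an integer polynomial takes `p`-integral values at integers. -/
theorem padicNorm_eval_map_le_one (P : ℤ[X]) (k : ℤ) :
    padicNorm p ((P.map (Int.castRingHom ℚ)).eval (k : ℚ)) ≤ 1 := by
  rw [show ((k : ℤ) : ℚ) = Int.castRingHom ℚ k from (eq_intCast _ k).symm, Polynomial.eval_map,
    Polynomial.eval₂_hom, eq_intCast]
  exact padicNorm.of_int _

/-- … and so does its derivative. -/
theorem padicNorm_eval_derivative_map_le_one (P : ℤ[X]) (k : ℤ) :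
    padicNorm p ((derivative (P.map (Int.castRingHom ℚ))).eval (k : ℚ)) ≤ 1 := by
  rw [Polynomial.derivative_map]
  exact padicNorm_eval_map_le_one _ _

/-- `‖block(−k)‖_p ≤ 1`. -/
theorem padicNorm_eval_block_le_one (lo hi k : ℤ) : padicNorm p ((block lo hi).eval (-(k : ℚ))) ≤ 1 := by
  rw [block_eq_map, show (-(k : ℚ)) = (((-k : ℤ)) : ℚ) by push_cast; ring]
  exact padicNorm_eval_map_le_one _ _

/-- `‖block′(−k)‖_p ≤ 1`. -/
theorem padicNorm_eval_derivative_block_le_one (lo hi k : ℤ) :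
    padicNorm p ((derivative (block lo hi)).eval (-(k : ℚ))) ≤ 1 := by
  rw [block_eq_map, show (-(k : ℚ)) = (((-k : ℤ)) : ℚ) by push_cast; ring]
  exact padicNorm_eval_derivative_map_le_one _ _

/-- `‖block2(−k)‖_p ≤ 1`. -/
theorem padicNorm_eval_block2_le_one (lo hi k : ℤ) : padicNorm p ((block2 lo hi).eval (-(k : ℚ))) ≤ 1 := by
  rw [block2_eq_map, show (-(k : ℚ)) = (((-k : ℤ)) : ℚ) by push_cast; ring]
  exact padicNorm_eval_map_le_one _ _

/-- `‖block2′(−k)‖_p ≤ 1`. -/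
theorem padicNorm_eval_derivative_block2_le_one (lo hi k : ℤ) :
    padicNorm p ((derivative (block2 lo hi)).eval (-(k : ℚ))) ≤ 1 := by
  rw [block2_eq_map, show (-(k : ℚ)) = (((-k : ℤ)) : ℚ) by push_cast; ring]
  exact padicNorm_eval_derivative_map_le_one _ _

/-! ### Norm bookkeeping -/

/-- `‖x·y‖ ≤ 1` from `‖x‖, ‖y‖ ≤ 1`. -/
private theorem mul_le_one' {x y : ℚ} (hx : padicNorm p x ≤ 1) (hy : padicNorm p y ≤ 1) :
    padicNorm p (x * y) ≤ 1 := by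
  rw [padicNorm.mul]; exact mul_le_one₀ hx (padicNorm.nonneg _) hy

/-- `‖x/y‖ ≤ 1` from `‖x‖ ≤ 1`, `‖y‖ = 1`. -/
private theorem div_le_one' {x y : ℚ} (hx : padicNorm p x ≤ 1) (hy : padicNorm p y = 1) :
    padicNorm p (x / y) ≤ 1 := by
  rw [padicNorm.div, hy, div_one]; exact hx

/-- `‖x + y‖ ≤ 1` from `‖x‖, ‖y‖ ≤ 1` (ultrametric). -/
private theorem add_le_one' {x y : ℚ} (hx : padicNorm p x ≤ 1) (hy : padicNorm p y ≤ 1) :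
    padicNorm p (x + y) ≤ 1 :=
  (padicNorm.nonarchimedean (p := p)).trans (max_le hx hy)

/-- `‖x − y‖ ≤ 1` from `‖x‖, ‖y‖ ≤ 1`. -/
private theorem sub_le_one' {x y : ℚ} (hx : padicNorm p x ≤ 1) (hy : padicNorm p y ≤ 1) :
    padicNorm p (x - y) ≤ 1 := by
  rw [sub_eq_add_neg]; exact add_le_one' hx (by rwa [padicNorm.neg])

/-! ### The large-prime hypotheses -/

/-- **Large prime** relative to the data `(â, b̂)`: `p` exceeds the two numerator block lengths, and every two indices of
the pole range `[min(â₂,â₃), b̂₃*)` differ by less than `p` (this covers both pole block lengths). -/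
structure LargePrime (p : ℕ) (a b : Fin 4 → ℤ) : Prop where
  /-- `â₀ − b̂₀ < p` -/
  len0 : a 0 - b 0 < p
  /-- `â₁ − b̂₁ < p` -/
  len1 : a 1 - b 1 < p
  /-- `b̂₃* − min(â₂, â₃) ≤ p` (pole span) -/
  span : bMax b - min (a 2) (a 3) ≤ p

variable {a b : Fin 4 → ℤ}

omit hp in
/-- Under `LargePrime`, all pole-span differences `i − k` (`i`, `k` in the span `[min(â₂,â₃), b̂₃*)`) have absolute
value `< p`. -/
theorem abs_sub_lt_of_large (hL : LargePrime p a b) {k i : ℤ} (hk : min (a 2) (a 3) ≤ k ∧ k < bMax b)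
    (hi : min (a 2) (a 3) ≤ i ∧ i < bMax b) : |i - k| < p := by
  have := hL.span
  rw [abs_lt]; constructor <;> omega

omit hp in
/-- Pole block `2` lies inside the pole span. -/
theorem mem_span_of_mem2 {i : ℤ} (hi : i ∈ Ico (a 2) (b 2)) : min (a 2) (a 3) ≤ i ∧ i < bMax b := by
  have := mem_Ico.1 hi
  exact ⟨(min_le_left _ _).trans this.1, lt_of_lt_of_le this.2 (le_max_left _ _)⟩

omit hp in
/-- Pole block `3` lies inside the pole span. -/
theorem mem_span_of_mem3 {i : ℤ} (hi : i ∈ Ico (a 3) (b 3)) : min (a 2) (a 3) ≤ i ∧ i < bMax b := by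
  have := mem_Ico.1 hi
  exact ⟨(min_le_right _ _).trans this.1, lt_of_lt_of_le this.2 (le_max_right _ _)⟩

/-- The common factor `(f₂/E₂)(f₃/E₃)(P₀(−k)/f₀)(P₁(−k)/f₁)` is `p`-integral for a large prime
(`k` anywhere in the pole span). -/
theorem padicNorm_numT_div_dhatT_le_one (hab : AdmissibleT a b) (hL : LargePrime p a b) {k : ℤ}
    (hk : min (a 2) (a 3) ≤ k ∧ k < bMax b) :
    padicNorm p ((numT a b).eval (-(k : ℚ)) / (dhatT a b k).eval (-(k : ℚ))) ≤ 1 := by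
  have ha2 := hab.a_lt 2 (by decide)
  have ha3 := hab.a_lt 3 (by decide)
  have hE2 : padicNorm p (coverProd (a 2) (b 2) k) = 1 :=
    padicNorm_coverProd_eq_one fun i hi _ => abs_sub_lt_of_large hL hk (mem_span_of_mem2 hi)
  have hE3 : padicNorm p (coverProd (a 3) (b 3) k) = 1 :=
    padicNorm_coverProd_eq_one fun i hi _ => abs_sub_lt_of_large hL hk (mem_span_of_mem3 hi)
  have hf2 : padicNorm p (facZ (b 2 - a 2 - 1)) ≤ 1 := by rw [facZ_eq]; exact_mod_cast padicNorm.of_int (p := p) _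
  have hf3 : padicNorm p (facZ (b 3 - a 3 - 1)) ≤ 1 := by rw [facZ_eq]; exact_mod_cast padicNorm.of_int (p := p) _
  have hf0 : padicNorm p (facZ (a 0 - b 0)) = 1 := padicNorm_facZ_eq_one_of_lt (sub_nonneg.2 hab.b0_le_a0) hL.len0
  have hf1 : padicNorm p (facZ (a 1 - b 1)) = 1 :=
    padicNorm_facZ_eq_one_of_lt (sub_nonneg.2 (hab.b1_le 1 (by decide))) hL.len1
  rw [numT_div_dhatT_eq]
  exact mul_le_one' (mul_le_one' (mul_le_one' (div_le_one' hf2 hE2) (div_le_one' hf3 hE3))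
    (div_le_one' (padicNorm_eval_block2_le_one _ _ _) hf0)) (div_le_one' (padicNorm_eval_block_le_one _ _ _) hf1)

/-! ### `A_k` and `B_k` are `p`-integral for large primes -/

/-- **`‖A_k‖_p ≤ 1` for a large prime** (double-pole range `k ∈ [â₂,b̂₂) ∩ [â₃,b̂₃)`). -/
theorem padicNorm_coefAT_le_one_of_large (hab : AdmissibleT a b) (hL : LargePrime p a b) {k : ℤ}
    (h2 : k ∈ Ico (a 2) (b 2)) (h3 : k ∈ Ico (a 3) (b 3)) : padicNorm p (coefAT a b k) ≤ 1 := by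
  unfold coefAT
  rw [qpolyT_eq_of_double h2 h3]
  exact padicNorm_numT_div_dhatT_le_one hab hL (mem_span_of_mem2 h2)

/-- **`‖B_k‖_p ≤ 1` for a large prime**, on the whole `B`-range `k ∈ [â₂,b̂₂) ∪ [â₃,b̂₃)`: at a double pole
`B_k = (f₂/E₂)(f₃/E₃)[P₀′P₁ + P₀P₁′ − P₀P₁(Σ₂+Σ₃)]/(f₀f₁)` (`coefBT_double_eq`) with every factor `p`-integral; at a
simple pole `B_k = numT(−k)/dhatT(−k)` (`coefBT_of_simple`). -/
theorem padicNorm_coefBT_le_one_of_large (hab : AdmissibleT a b) (hL : LargePrime p a b) {k : ℤ}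
    (hk : k ∈ Ico (a 2) (b 2) ∨ k ∈ Ico (a 3) (b 3)) : padicNorm p (coefBT a b k) ≤ 1 := by
  have hspan : min (a 2) (a 3) ≤ k ∧ k < bMax b := by
    rcases hk with h | h
    · exact mem_span_of_mem2 h
    · exact mem_span_of_mem3 h
  by_cases h2m : k ∈ Ico (a 2) (b 2) <;> by_cases h3m : k ∈ Ico (a 3) (b 3)
  · -- double pole
    have hE2 : padicNorm p (coverProd (a 2) (b 2) k) = 1 :=
      padicNorm_coverProd_eq_one fun i hi _ => abs_sub_lt_of_large hL hspan (mem_span_of_mem2 hi)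
    have hE3 : padicNorm p (coverProd (a 3) (b 3) k) = 1 :=
      padicNorm_coverProd_eq_one fun i hi _ => abs_sub_lt_of_large hL hspan (mem_span_of_mem3 hi)
    have hf2 : padicNorm p (facZ (b 2 - a 2 - 1)) ≤ 1 := by rw [facZ_eq]; exact_mod_cast padicNorm.of_int (p := p) _
    have hf3 : padicNorm p (facZ (b 3 - a 3 - 1)) ≤ 1 := by rw [facZ_eq]; exact_mod_cast padicNorm.of_int (p := p) _
    have hf0 : padicNorm p (facZ (a 0 - b 0)) = 1 := padicNorm_facZ_eq_one_of_lt (sub_nonneg.2 hab.b0_le_a0) hL.len0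
    have hf1 : padicNorm p (facZ (a 1 - b 1)) = 1 :=
      padicNorm_facZ_eq_one_of_lt (sub_nonneg.2 (hab.b1_le 1 (by decide))) hL.len1
    have hV := mul_le_one' (div_le_one' hf2 hE2) (div_le_one' hf3 hE3)
    have hP0 := div_le_one' (padicNorm_eval_block2_le_one (p := p) (b 0) (a 0) k) hf0
    have hP0' := div_le_one' (padicNorm_eval_derivative_block2_le_one (p := p) (b 0) (a 0) k) hf0
    have hP1 := div_le_one' (padicNorm_eval_block_le_one (p := p) (b 1) (a 1) k) hf1
    have hP1' := div_le_one' (padicNorm_eval_derivative_block_le_one (p := p) (b 1) (a 1) k) hf1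
    have hS : padicNorm p (∑ i ∈ (Ico (a 2) (b 2)).erase k, 1 / ((i : ℚ) - k)
        + ∑ i ∈ (Ico (a 3) (b 3)).erase k, 1 / ((i : ℚ) - k)) ≤ 1 :=
      add_le_one' (padicNorm_sum_inv_le_one fun i hi _ => abs_sub_lt_of_large hL hspan (mem_span_of_mem2 hi))
        (padicNorm_sum_inv_le_one fun i hi _ => abs_sub_lt_of_large hL hspan (mem_span_of_mem3 hi))
    rw [coefBT_double_eq h2m h3m]
    exact mul_le_one' hV (sub_le_one' (add_le_one' (mul_le_one' hP0' hP1) (mul_le_one' hP0 hP1'))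
      (mul_le_one' (mul_le_one' hP0 hP1) hS))
  · -- simple pole in block 2
    have hm : multT a b k = 1 := by unfold multT; rw [if_pos h2m, if_neg h3m]
    rw [coefBT_of_simple hm]
    exact padicNorm_numT_div_dhatT_le_one hab hL hspan
  · -- simple pole in block 3
    have hm : multT a b k = 1 := by unfold multT; rw [if_neg h2m, if_pos h3m]
    rw [coefBT_of_simple hm]
    exact padicNorm_numT_div_dhatT_le_one hab hL hspan
  · exact absurd hk (by tauto)

end Summit.KontsevichZagierPeriods.Zeta5Search.SecondTaleLargePrime

end
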